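import Literature.Computability.Complexity.RandomOraclePH
import Literature.Computability.Complexity.RandomOraclePHSipser
import Literature.Computability.Complexity.RandomOraclePHAsymptotics
import Literature.Computability.Complexity.RandomOraclePHSipserProofs
import Literature.Computability.Complexity.AverageCaseDepthHierarchyProofs
import Literature.Computability.Complexity.CircuitInputMap
import Literature.Computability.QuantumComplexity.RandomOracleIndependence
import Literature.Computability.QuantumComplexity.OracleSeparationBQPPHProofs
import Literature.Barriers.QuantumAdvantage.AaronsonChenPH
import HarnessLib

/-!
# `PH` is infinite relative to a random oracle: Thm. 2 of Rossman–Servedio–Tan from Thm. 1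

B. Rossman, R. A. Servedio, L.-Y. Tan, *An average-case depth hierarchy theorem for Boolean
circuits*, FOCS 2015, arXiv:1504.03398 [RossmanServedioTan2015], **Theorem 2** (p. 3; §2.3
p. 7): "with probability `1`, a random oracle `A` satisfies `Σ_d^{P,A} ⊊ Σ_{d+1}^{P,A}` for all
`d ∈ ℕ`" — the tree's named fact `rossmanServedioTan2015_thm2` (`RandomOraclePH.lean`). The paper
derives it from its Theorem 1 (the average-case depth hierarchy theorem; in the tree the
corrected transcription `rossmanServedioTan2015_thm1_inRegime` of `AverageCaseDepthHierarchy.lean`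
= Thm. 1 with the regime `d ≤ c m / log₂ m` of Lemma 7.1, see the design note "Circularity of
the printed range" there) "via a classical connection
between small-depth computation and the polynomial hierarchy [FSS81, Sipser 1983]", referring to
Ch. 7 of Håstad's thesis for the derivation (§2.3, p. 7). This file PROVES that derivation in the
tree's models:

* `rossmanServedioTan2015_thm2_of` — **Thm. 2 from Thm. 1**:
  `rossmanServedioTan2015_thm1_inRegime → rossmanServedioTan2015_w0_asymp → sipserLang_mem_PHRel →
  rossmanServedioTan2015_thm2`, i.e. Thm. 2 holds conditionally on exactly (i) Thm. 1 in the
  regime of Lemma 7.1 (the literal `rossmanServedioTan2015_thm1` implies it), (ii) the printed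
  estimate `w₀ = 2^m ln 2 (1 ± o(1))` of the top fan-in of `Sipser_d` (§6, p. 15; it makes the
  number of variables tend to infinity; proved in `AverageCaseDepthHierarchyProofs.lean`), and
  (iii) the routine membership of the diagonal languages in `PH^A` (`RandomOraclePHSipser.lean`,
  proved in `RandomOraclePHSipserProofs.lean`);
* `rossmanServedioTan2015_thm2_of_inRegime` — **Thm. 2 from Thm. 1 in the regime of Lemma 7.1
  ALONE**, feeding (ii) and (iii) by their discharges `rossmanServedioTan2015_w0_asymp_holds` and
  `sipserLang_mem_PHRel_holds`: the average-case depth hierarchy theorem is the only hypothesis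
  left, and `rossmanServedioTan2015_thm2_holds` will be this theorem applied to
  `rossmanServedioTan2015_thm1_inRegime_holds`; `rossmanServedioTan2015_thm2_of_thm1` is the same
  from the literal transcription `rossmanServedioTan2015_thm1`.

The argument (Furst–Saxe–Sipser 1984 / Sipser 1983 / Håstad 1986, Ch. 7; Ko 1989, §2 and §4.2;
the measure-one bookkeeping of Bennett–Gill 1981, §1), level by level:

1. `exists_levelLang_of_mem_sigmaPRel`: a `Σₖ^A` language is described by `k` polynomial
   quantifier bounds over a polynomial-time base oracle machine (`levelLang`, Stockmeyer);
2. for a fixed description `Dsc` and RST parameter `m`, the event `correctAt k Dsc m` — "`Dsc`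
   decides the Sipser language of depth `D = k + 3` correctly at the input `sipserInput m D`" —
   depends only on the oracle below length `reachAt k Dsc m` (`correctAt_congr`), and, for EVERY
   background oracle, at most a `3/5` fraction of the `2ⁿ` settings of the level window
   (`levelWindow k m`, the `n = rstN m D` leaf addresses) make it happen once `m` is large
   (`goodWindows_correctAt_le`): the predicate at this input is an `acBasis` circuit of
   `acDepth ≤ k + 2 = D - 1` and size `2^{poly(|x|)} = 2^{polylog n}` in the window bits
   (the tree's PROVED `fSS84_phWindowCircuits_holds`, transported to the leaves of `Sipser_D` by
   `Circuit.mapInputs`), the language at this input is `Sipser_D` of the window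
   (`sipserInput_mem_iff`), and Thm. 1 in the form `rst_thm1_regime_of_inRegime`
   (`RandomOraclePHAsymptotics.lean`) bounds the agreement;
3. along the sparse parameters `sparseParam` (each level beyond the reach of all earlier ones)
   the product bound `measure_iInter_eq_zero_of_windows` (`RandomOracleIndependence.lean`) gives
   probability `0` that `Dsc` is correct at all of them (`measure_correctAt_sparse_eq_zero`), hence
   probability `0` that `Dsc` describes the Sipser language (`measure_lang_eq_sipserLang_eq_zero`);
   over the countably many descriptions
   (`countable_polyTimeOracleAlg_holds`), almost surely `sipserLang (k+3) A ∉ Σₖ^A`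
   (`ae_sipserLang_not_mem_sigmaPRel`);
4. with `sipserLang (k+3) A ∈ PH^A` for all `k` this says that every level misses a `PH^A`
   language, so no two consecutive levels coincide (`isInfinitePHRel_of_forall_exists`,
   `AaronsonChenPH.lean` — the definitional upward collapse), and `Σ_d^A ⊆ Σ_{d+1}^A`
   (`SigmaPRel_subset_succ`, ibid.) makes the inclusions strict.

Also recorded: `patchFin_eq_patchLang` (the window patch of `RandomOracleIndependence.lean` is
`patchLang` of `OracleSeparationBQPPH.lean` along the inclusion) and `patchLang_comp_equiv`.
The bookkeeping objects of the diagonalization (`sipserDepth`, `correctAt`, `levelWindow`,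
`reachAt`, `sparseParam` and their lemmas) live in the sub-namespace `RandomOraclePH`.

## References

* [RossmanServedioTan2015] arXiv:1504.03398, Thm. 2 (p. 3), §2.3 (p. 7), Thm. 1, §6.
* [Ko1989] K.-I Ko, *Constructing oracles by lower bound techniques for circuits* (1989), §2
  (Lemmas 2.1, 2.3), §4.2 (p. 15–16).
* [BennettGill1981] C. H. Bennett, J. Gill, SIAM J. Comput. 10 (1981), §1.
* [FurstSaxeSipser1984], [Sipser1983], [Hastad1986] (the connection; Håstad's thesis Ch. 7).
-/

noncomputable section

namespace Literature.Computability.Complexity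

open _root_.MeasureTheory _root_.Computability Literature.Computability.QuantumComplexity
  Literature.Barriers.QuantumAdvantage Finset
open scoped ENNReal

/-! ### Patching: the two spellings agree -/

/-- Re-indexing a patch along a bijection of the window does not change the patched language. [folklore] -/
theorem patchLang_comp_equiv {ι κ : Type*} (A₀ : Language Bool) (e : ι → List Bool) (ρ : κ ≃ ι)
    (w : ι → Bool) : patchLang A₀ (e ∘ ρ) (w ∘ ρ) = patchLang A₀ e w := by
  ext s
  simp only [patchLang, Function.comp_apply, ne_eq]
  constructor
  · rintro (⟨k, hk, hw⟩ | ⟨hne, hs⟩)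
    · exact Or.inl ⟨ρ k, hk, hw⟩
    · exact Or.inr ⟨fun k hk => hne (ρ.symm k) (by simpa using hk), hs⟩
  · rintro (⟨k, hk, hw⟩ | ⟨hne, hs⟩)
    · exact Or.inl ⟨ρ.symm k, by simpa using hk, by simpa using hw⟩
    · exact Or.inr ⟨fun k hk => hne (ρ k) hk, hs⟩

/-- **`patchFin` is `patchLang` along the inclusion of the window** (the identity promised in
`RandomOracleIndependence.lean`). [folklore] -/
theorem patchFin_eq_patchLang (A₀ : Set (List Bool)) (U : Finset (List Bool)) (w : U → Bool) :
    patchFin A₀ U w = patchLang A₀ (Subtype.val : U → List Bool) w := by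
  ext s
  by_cases hs : s ∈ U
  · rw [mem_patchFin_of_mem w hs]
    exact (mem_patchLang_of_eq Subtype.val_injective w ⟨s, hs⟩).symm
  · rw [mem_patchFin_of_not_mem w hs]
    exact (mem_patchLang_of_not_mem_range w fun k hk => by subst hk; exact hs k.2).symm

/-! ### Descriptions of `Σₖ^A` languages -/

/-- **Every `Σₖ^A` language has a description with exactly `k` quantifier bounds** over a
polynomial-time base oracle machine (unfolding `sigmaP (PRel O) k`; the `k`-tracking form of
`exists_PHDescr_of_mem_PHRel`). [cite: Stockmeyer1976, §3] -/
theorem exists_levelLang_of_mem_sigmaPRel {A : Language Bool} :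
    ∀ {k : ℕ} {L : Language Bool}, L ∈ SigmaPRel (Oracle.ofLanguage A) k →
      ∃ (ps : List (Polynomial ℕ)) (M : OracleAlg Bool) (q : Polynomial ℕ),
        M.IsPolyTime encodingBoolBool ∧ ps.length = k ∧ L = levelLang M q A ps
  | 0, L, hL => by
    obtain ⟨M, hM, q, hq⟩ := hL
    exact ⟨[], M, q, hM, rfl, (baseLang_eq_of_PRel hq).symm⟩
  | k + 1, L, hL => by
    obtain ⟨L', hL', p, hp⟩ := hL
    obtain ⟨ps, M, q, hM, hlen, hps⟩ := exists_levelLang_of_mem_sigmaPRel (k := k) (L := L'ᶜ) hL'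
    refine ⟨p :: ps, M, q, hM, by simp [hlen], ?_⟩
    ext x
    rw [hp x, mem_levelLang_cons, ← hps]
    simp only [not_mem_compl_language_iff]

/-! ### The events, windows and reaches of the diagonalization -/

namespace RandomOraclePH

/-- The depth of the Sipser language used against level `k`: `D = k + 3` (a `Σₖ^A` predicate is a
depth-`(k+2)` circuit in the window, `FSS84_phWindowCircuits`, and Thm. 1 defeats depth `D - 1`). [cite: RossmanServedioTan2015, §2.3 (p. 7)] -/
abbrev sipserDepth (k : ℕ) : ℕ := k + 3

/-- The event "the description `Dsc` decides the depth-`(k+3)` Sipser language correctly at the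
RST input of parameter `m`". [cite: BennettGill1981, §1] -/
def correctAt (k : ℕ) (Dsc : PHDescr) (m : ℕ) : Set (Set (List Bool)) :=
  {A | sipserInput m (sipserDepth k) ∈ Dsc.lang A ↔
    sipserInput m (sipserDepth k) ∈ sipserLang (sipserDepth k) A}

/-- The level window at parameter `m`: the leaf addresses of the RST input. [cite: Ko1989, §4.2 (p. 15)] -/
def levelWindow (k m : ℕ) : Finset (List Bool) :=
  sipserWindow (sipserInput m (sipserDepth k)) (rstFanins m (sipserDepth k))

/-- The oracle length up to which `correctAt k Dsc m` reads the oracle: the reach of the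
description and the window length `2|x|` at the RST input `x`. [cite: BennettGill1981, §1] -/
def reachAt (k : ℕ) (Dsc : PHDescr) (m : ℕ) : ℕ :=
  max (Dsc.reach (sipserInput m (sipserDepth k)).length) (2 * (sipserInput m (sipserDepth k)).length)

/-- **Locality of the events**: oracles agreeing below the reach agree on `correctAt`. [cite: BennettGill1981, §1] -/
theorem correctAt_congr {k : ℕ} {Dsc : PHDescr} {m : ℕ} {A A' : Set (List Bool)}
    (h : ∀ s : List Bool, s.length ≤ reachAt k Dsc m → (s ∈ A ↔ s ∈ A')) :
    A ∈ correctAt k Dsc m ↔ A' ∈ correctAt k Dsc m := by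
  simp only [correctAt, Set.mem_setOf_eq]
  rw [Dsc.lang_congr (sipserInput m (sipserDepth k)) fun s hs => h s (hs.trans (le_max_left _ _)),
    sipserLang_congr (A := A) (A' := A') fun s hs => h s (hs.le.trans (le_max_right _ _))]

/-- The events are measurable. [folklore] -/
theorem measurableSet_correctAt (k : ℕ) (Dsc : PHDescr) (m : ℕ) : MeasurableSet (correctAt k Dsc m) :=
  measurableSet_of_determined (reachAt k Dsc m) fun _ _ h => correctAt_congr h

/-- Window strings at parameter `m` have length `2|x|`. [folklore] -/
theorem length_of_mem_levelWindow {k m : ℕ} {s : List Bool} (hs : s ∈ levelWindow k m) :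
    s.length = 2 * (sipserInput m (sipserDepth k)).length :=
  length_of_mem_sipserWindow hs

/-- Clearing a window of long strings does not affect an event of smaller reach. [cite: BennettGill1981, §1] -/
theorem correctAt_iff_sdiff {k : ℕ} {Dsc : PHDescr} {m m' : ℕ}
    (hlt : reachAt k Dsc m < 2 * (sipserInput m' (sipserDepth k)).length) (A : Set (List Bool)) :
    A ∈ correctAt k Dsc m ↔ A \ ↑(levelWindow k m') ∈ correctAt k Dsc m := by
  refine correctAt_congr fun s hs => ?_
  simp only [Set.mem_sdiff, Finset.mem_coe, iff_self_and]
  intro _ hsU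
  have := length_of_mem_levelWindow hsU
  omega

end RandomOraclePH

/-! ### The per-level bound: Thm. 1 against the window circuit of the description -/

/-- The fan-ins of an RST input are positive in the regime `m, w, w₀ ≥ 1`. [folklore] -/
theorem one_le_of_mem_rstFanins {m D : ℕ} (hm : 1 ≤ m) (hW : 1 ≤ rstW m) (hW0 : 1 ≤ rstW0 m D) :
    ∀ v ∈ rstFanins m D, 1 ≤ v := by
  intro v hv
  simp only [rstFanins, List.mem_cons, List.mem_append, List.mem_replicate, List.not_mem_nil,
    or_false] at hv
  rcases hv with rfl | ⟨-, rfl⟩ | rfl <;> assumption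

/-- **The RST input is short**: in the regime `m, w, w₀ ≥ 1`, `m ≤ log₂ n + 2`, its length is at
most `6 log₂ n + 12 D + 9` (the fan-ins are coded in binary). [folklore] -/
theorem length_sipserInput_le {m D : ℕ} (hD : 2 ≤ D) (hm : 1 ≤ m) (hW : 1 ≤ rstW m)
    (hW0 : 1 ≤ rstW0 m D) (hlog : m ≤ Nat.log 2 (rstN m D) + 2) :
    (sipserInput m D).length ≤ 6 * Nat.log 2 (rstN m D) + (12 * D + 9) := by
  rw [length_sipserInput, length_encode_listNat, length_rstFanins hD]
  have hsz := sum_size_le_log_prod (rstFanins m D) (one_le_of_mem_rstFanins hm hW hW0)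
  rw [length_rstFanins hD] at hsz
  change ((rstFanins m D).map Nat.size).sum ≤ Nat.log 2 (rstN m D) + D at hsz
  have hsize : (rstN m D).size ≤ Nat.log 2 (rstN m D) + 1 :=
    Nat.size_le.2 (Nat.lt_pow_succ_log_self one_lt_two _)
  have hmax : max (rstN m D).size m ≤ Nat.log 2 (rstN m D) + 1 + m :=
    max_le (hsize.trans (Nat.le_add_right _ _)) (Nat.le_add_left _ _)
  omega

namespace RandomOraclePH

/-- **The per-level bound.** Assuming Thm. 1 (in the regime of Lemma 7.1,
`rossmanServedioTan2015_thm1_inRegime`) and the `w₀` estimate: for a description `Dsc` with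
`k` quantifier bounds and window circuits of size `2^{S(|x|)}` (the shape of
`FSS84_phWindowCircuits`), for all large `m` and EVERY background oracle `A₀`, at most a
`3/5`-fraction of the settings of the level window make `Dsc` correct at the RST input of
parameter `m` about the depth-`(k+3)` Sipser language. [cite: RossmanServedioTan2015, Thm. 1 and §2.3] [cite: Ko1989, Lemma 2.3 and §4.2] -/
theorem goodWindows_correctAt_le (h1 : rossmanServedioTan2015_thm1_inRegime)
    (h0 : rossmanServedioTan2015_w0_asymp) (k : ℕ) (Dsc : PHDescr) (hk : Dsc.bounds.length = k)
    {S : Polynomial ℕ}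
    (hS : ∀ (x : List Bool) (W : ℕ) (e : Fin W → List Bool), Function.Injective e →
      ∀ A₀ : Language Bool, ∃ C : Circuit (Fin W), C.IsOver acBasis ∧
        C.acDepth ≤ Dsc.bounds.length + 2 ∧ C.size ≤ 2 ^ S.eval x.length ∧
        ∀ w : Fin W → Bool, C.eval w = (Dsc.lang (patchLang A₀ e w)).boolIndicator x) :
    ∃ m₁ : ℕ, ∀ m : ℕ, m₁ ≤ m → ∀ A₀ : Set (List Bool),
      ((goodWindows (correctAt k Dsc m) (levelWindow k m) A₀).card : ℝ≥0∞) *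
          2⁻¹ ^ (levelWindow k m).card ≤ ENNReal.ofReal (3 / 5) := by
  classical
  obtain ⟨c₂, kk, hck⟩ := exists_eval_le_mul_pow_add S
  have hD : 2 ≤ sipserDepth k := by simp [sipserDepth]
  obtain ⟨m₁, hm₁⟩ := rst_thm1_regime_of_inRegime h1 h0 hD c₂ kk 6 (12 * sipserDepth k + 9)
  refine ⟨m₁, fun m hm A₀ => ?_⟩
  obtain ⟨⟨hm1, hW, hW0, hlog⟩, hthm⟩ := hm₁ m hm
  set D : ℕ := sipserDepth k with hDdef
  set x : List Bool := sipserInput m D with hx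
  set ws : List ℕ := rstFanins m D with hws
  set n : ℕ := rstN m D with hn
  have hfit : ws.prod ≤ 2 ^ x.length := (rstN_lt_two_pow_length_sipserInput m D).le
  -- the window, its bijections with the leaves and with `Fin n`
  set U : Finset (List Bool) := levelWindow k m with hU
  have hUeq : U = sipserWindow x ws := rfl
  set σ : Addr ws ≃ U := hUeq ▸ sipserLeafEquiv x ws hfit with hσ
  set τ : Addr ws ≃ Fin (Fintype.card (Addr ws)) := Fintype.equivFin (Addr ws) with hτ
  set ρ : Fin (Fintype.card (Addr ws)) ≃ U := τ.symm.trans σ with hρ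
  set e : Fin (Fintype.card (Addr ws)) → List Bool := fun i => (ρ i : List Bool) with he
  have heinj : Function.Injective e := Subtype.val_injective.comp ρ.injective
  -- the window circuit of the description at `x`, moved to the leaves
  obtain ⟨C, hCB, hCd, hCs, hCev⟩ := hS x _ e heinj A₀
  set F : Circuit (Addr ws) := C.mapInputs τ.symm with hF
  have hFB : F.IsOver acBasis := hCB.mapInputs _
  have hFd : F.acDepth ≤ D - 1 := by
    rw [hF, Circuit.acDepth_mapInputs, hk] at *
    simpa [hDdef, sipserDepth] using hCd
  have hlen : x.length ≤ 6 * Nat.log 2 n + (12 * D + 9) := length_sipserInput_le hD hm1 hW hW0 hlog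
  have hFs : F.size ≤ 2 ^ (c₂ * (6 * Nat.log 2 n + (12 * D + 9)) ^ kk + c₂) := by
    rw [hF, Circuit.size_mapInputs]
    refine hCs.trans (Nat.pow_le_pow_right (by norm_num) ?_)
    exact (TM2Iter.eval_mono S hlen).trans (hck _)
  have hcard := hthm F hFB hFd hFs
  -- identify the good windows with the agreements of `F` with `Sipser_D`
  have hσval : ∀ a : Addr ws, ((σ a : U) : List Bool) = sipserLeaf x ws a := by
    intro a
    rw [hσ]
    -- `hUeq ▸` is a cast along `rfl`
    rfl
  have key : ∀ w : U → Bool,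
      patchFin A₀ U w ∈ correctAt k Dsc m ↔ F.eval (w ∘ σ) = balancedSipser m D (w ∘ σ) := by
    intro w
    have hpatch : patchFin A₀ U w = patchLang A₀ e (w ∘ ρ) := by
      rw [patchFin_eq_patchLang]
      exact (patchLang_comp_equiv A₀ Subtype.val ρ w).symm
    have hbits : (fun a => (patchFin A₀ U w).boolIndicator (sipserLeaf x ws a)) = w ∘ σ := by
      funext a
      have hmem : sipserLeaf x ws a ∈ patchFin A₀ U w ↔ w (σ a) = true := by
        rw [mem_patchFin_of_mem w (hσval a ▸ (σ a).2)]
        exact Iff.of_eq (by congr 1)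
      rw [Function.comp_apply, Bool.eq_iff_iff, ← Set.mem_iff_boolIndicator]
      exact hmem
    have hF' : F.eval (w ∘ σ) = C.eval (w ∘ ρ) := by
      rw [hF, Circuit.eval_mapInputs]
      rfl
    have hC : sipserInput m (sipserDepth k) ∈ Dsc.lang (patchLang A₀ e (w ∘ ρ)) ↔
        C.eval (w ∘ ρ) = true := by
      rw [hCev]
      exact Set.mem_iff_boolIndicator _ _
    simp only [correctAt, Set.mem_setOf_eq]
    rw [sipserInput_mem_iff hD, hbits, hF', hpatch, Bool.eq_iff_iff (a := C.eval (w ∘ ρ)), hC]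
  have hcardeq : (goodWindows (correctAt k Dsc m) U A₀).card =
      ((univ : Finset (Addr ws → Bool)).filter fun u => F.eval u = balancedSipser m D u).card := by
    refine card_bij (fun w _ => w ∘ σ) (fun w hw => ?_) (fun w₁ _ w₂ _ h => ?_) (fun u hu => ?_)
    · rw [mem_goodWindows_iff] at hw
      exact mem_filter.2 ⟨mem_univ _, (key w).1 hw⟩
    · funext s
      simpa using congrFun h (σ.symm s)
    · refine ⟨u ∘ σ.symm, ?_, ?_⟩
      · rw [mem_goodWindows_iff, key]
        have : (u ∘ σ.symm) ∘ σ = u := by funext a; simp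
        rw [this]
        exact (mem_filter.1 hu).2
      · funext a; simp
  have hUcard : U.card = n := card_sipserWindow hfit
  -- the real bound, as a bound in `ℝ≥0∞`
  have hreal : ((goodWindows (correctAt k Dsc m) U A₀).card : ℝ) ≤ 3 / 5 * 2 ^ n := by
    rw [hcardeq]; exact hcard
  rw [hUcard, ENNReal.le_ofReal_iff_toReal_le (ENNReal.mul_ne_top (ENNReal.natCast_ne_top _)
    (ENNReal.pow_ne_top (ENNReal.inv_ne_top.2 two_ne_zero))) (by norm_num)]
  rw [ENNReal.toReal_mul, ENNReal.toReal_pow, ENNReal.toReal_inv, ENNReal.toReal_natCast,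
    ENNReal.toReal_ofNat]
  have h2 : (0 : ℝ) < 2 ^ n := by positivity
  calc ((goodWindows (correctAt k Dsc m) U A₀).card : ℝ) * 2⁻¹ ^ n
      = ((goodWindows (correctAt k Dsc m) U A₀).card : ℝ) / 2 ^ n := by
        rw [inv_pow, div_eq_mul_inv]
    _ ≤ 3 / 5 * 2 ^ n / 2 ^ n := by gcongr
    _ = 3 / 5 := by field_simp

/-! ### The sparse parameters and probability zero for one description -/

/-- The sparse sequence of parameters: start at `m₁`, and let each parameter exceed the previous
one and the reach of the event at the previous one (so that its window, made of strings of length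
`≥ 2m`, is invisible to all earlier events). [cite: BennettGill1981, §1] -/
def sparseParam (k : ℕ) (Dsc : PHDescr) (m₁ : ℕ) : ℕ → ℕ
  | 0 => m₁
  | j + 1 => max (sparseParam k Dsc m₁ j + 1) (reachAt k Dsc (sparseParam k Dsc m₁ j) + 1)

/-- The sparse parameters start above `m₁`. [folklore] -/
theorem le_sparseParam (k : ℕ) (Dsc : PHDescr) (m₁ : ℕ) : ∀ j, m₁ ≤ sparseParam k Dsc m₁ j
  | 0 => le_rfl
  | j + 1 => (le_sparseParam k Dsc m₁ j).trans
      ((Nat.le_succ _).trans (le_max_left _ _))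

/-- The sparse parameters are strictly increasing. [folklore] -/
theorem sparseParam_strictMono (k : ℕ) (Dsc : PHDescr) (m₁ : ℕ) : StrictMono (sparseParam k Dsc m₁) :=
  strictMono_nat_of_lt_succ fun j => Nat.lt_of_succ_le (le_max_left (sparseParam k Dsc m₁ j + 1) _)

/-- Each sparse parameter exceeds the reaches at all earlier ones. [folklore] -/
theorem reachAt_lt_sparseParam (k : ℕ) (Dsc : PHDescr) (m₁ : ℕ) {i j : ℕ} (hij : i < j) :
    reachAt k Dsc (sparseParam k Dsc m₁ i) < sparseParam k Dsc m₁ j := by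
  have h1 : reachAt k Dsc (sparseParam k Dsc m₁ i) < sparseParam k Dsc m₁ (i + 1) :=
    Nat.lt_of_succ_le (le_max_right _ _)
  exact h1.trans_le ((sparseParam_strictMono k Dsc m₁).monotone hij)

/-- **A fixed description is correct at all sparse parameters with probability `0`.**
[cite: BennettGill1981, §1] [cite: RossmanServedioTan2015, §2.3 (p. 7)] -/
theorem measure_correctAt_sparse_eq_zero (h1 : rossmanServedioTan2015_thm1_inRegime)
    (h0 : rossmanServedioTan2015_w0_asymp) (k : ℕ) (Dsc : PHDescr) (hk : Dsc.bounds.length = k) :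
    ∃ m₁ : ℕ, randomOracleMeasure (⋂ j, correctAt k Dsc (sparseParam k Dsc m₁ j)) = 0 := by
  obtain ⟨S, hS⟩ := fSS84_phWindowCircuits_holds Dsc
  obtain ⟨m₁, hm₁⟩ := goodWindows_correctAt_le h1 h0 k Dsc hk hS
  refine ⟨m₁, measure_iInter_eq_zero_of_windows (fun j => levelWindow k (sparseParam k Dsc m₁ j))
    (fun j => correctAt k Dsc (sparseParam k Dsc m₁ j)) (θ := ENNReal.ofReal (3 / 5))
    (ENNReal.ofReal_lt_one.2 (by norm_num)) (fun _ => measurableSet_correctAt k Dsc _)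
    (fun i j hij A => correctAt_iff_sdiff ?_ A) (fun j A₀ => hm₁ _ (le_sparseParam k Dsc m₁ j) A₀)⟩
  have h := reachAt_lt_sparseParam k Dsc m₁ hij
  have hlen := le_length_sipserInput (sparseParam k Dsc m₁ j) (sipserDepth k)
  omega

/-- **A fixed description describes the Sipser language with probability `0`.** [cite: RossmanServedioTan2015, §2.3 (p. 7)] [cite: BennettGill1981, §1] -/
theorem measure_lang_eq_sipserLang_eq_zero (h1 : rossmanServedioTan2015_thm1_inRegime)
    (h0 : rossmanServedioTan2015_w0_asymp) (k : ℕ) (Dsc : PHDescr) (hk : Dsc.bounds.length = k) :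
    randomOracleMeasure {A | ∀ x : List Bool,
      x ∈ Dsc.lang A ↔ x ∈ sipserLang (sipserDepth k) A} = 0 := by
  obtain ⟨m₁, hm₁⟩ := measure_correctAt_sparse_eq_zero h1 h0 k Dsc hk
  exact measure_mono_null (fun A hA => Set.mem_iInter.2 fun j => hA _) hm₁

end RandomOraclePH

/-! ### Almost surely the Sipser language escapes `Σₖ^A`; the assembly -/

open RandomOraclePH in
/-- **Almost surely `sipserLang (k+3) A ∉ Σₖ^A`** (countable union over the descriptions of
`Σₖ^A` languages). [cite: RossmanServedioTan2015, Thm. 2 and §2.3 (p. 7)] -/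
theorem ae_sipserLang_not_mem_sigmaPRel (h1 : rossmanServedioTan2015_thm1_inRegime)
    (h0 : rossmanServedioTan2015_w0_asymp) (k : ℕ) :
    ∀ᵐ A ∂randomOracleMeasure, sipserLang (sipserDepth k) A ∉ SigmaPRel (Oracle.ofLanguage A) k := by
  rw [ae_iff]
  obtain ⟨en, hen⟩ := exists_enum_PHDescr countable_polyTimeOracleAlg_holds
  have hsub : {A : Set (List Bool) | ¬ sipserLang (sipserDepth k) A ∉ SigmaPRel (Oracle.ofLanguage A) k} ⊆
      ⋃ i, {A | (en i).bounds.length = k ∧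
        ∀ x : List Bool, x ∈ (en i).lang A ↔ x ∈ sipserLang (sipserDepth k) A} := by
    intro A hA
    simp only [not_not, Set.mem_setOf_eq] at hA
    obtain ⟨ps, M, q, hM, hlen, hL⟩ := exists_levelLang_of_mem_sigmaPRel hA
    obtain ⟨i, hi⟩ := hen (show (⟨ps, M, q⟩ : PHDescr) ∈ {D : PHDescr | D.M.IsPolyTime encodingBoolBool}
      from hM)
    refine Set.mem_iUnion.2 ⟨i, ?_⟩
    rw [Set.mem_setOf_eq, hi]
    exact ⟨hlen, fun x => by rw [hL]; rfl⟩
  refine measure_mono_null hsub (measure_iUnion_null fun i => ?_)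
  by_cases hk : (en i).bounds.length = k
  · exact measure_mono_null (fun A hA => hA.2) (measure_lang_eq_sipserLang_eq_zero h1 h0 k (en i) hk)
  · have : {A : Set (List Bool) | (en i).bounds.length = k ∧
        ∀ x : List Bool, x ∈ (en i).lang A ↔ x ∈ sipserLang (sipserDepth k) A} = ∅ := by
      ext A; simp [hk]
    rw [this, measure_empty]

open RandomOraclePH in
/-- **Rossman–Servedio–Tan 2015, Thm. 2, from Thm. 1** (the derivation "via Chapter 7 of Håstad's
thesis", here via Ko 1989 §2/§4.2 and Bennett–Gill 1981 §1): assuming the average-case depth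
hierarchy theorem in the regime of Lemma 7.1 (`rossmanServedioTan2015_thm1_inRegime`), the
printed top fan-in estimate (`rossmanServedioTan2015_w0_asymp`) and the membership of the
diagonal Sipser languages in `PH^A` (`sipserLang_mem_PHRel`), with probability `1` a random
oracle `A` satisfies
`Σ_d^{P,A} ⊊ Σ_{d+1}^{P,A}` for all `d`. [cite: RossmanServedioTan2015, Thm. 2 (p. 3) and §2.3 (p. 7)] -/
theorem rossmanServedioTan2015_thm2_of (h1 : rossmanServedioTan2015_thm1_inRegime)
    (h0 : rossmanServedioTan2015_w0_asymp) (hU : sipserLang_mem_PHRel) :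
    rossmanServedioTan2015_thm2 := by
  have h : ∀ᵐ A ∂randomOracleMeasure, ∀ k : ℕ,
      sipserLang (sipserDepth k) A ∉ SigmaPRel (Oracle.ofLanguage A) k :=
    ae_all_iff.2 fun k => ae_sipserLang_not_mem_sigmaPRel h1 h0 k
  refine h.mono fun A hA d => ?_
  have hinf : IsInfinitePHRel (Oracle.ofLanguage A) :=
    isInfinitePHRel_of_forall_exists fun k => ⟨_, hU (sipserDepth k) A, hA k⟩
  exact ⟨SigmaPRel_subset_succ _ d, fun hsub =>
    hinf d (Set.Subset.antisymm (SigmaPRel_subset_succ _ d) hsub)⟩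

/-- **Thm. 2 from Thm. 1 in the regime of Lemma 7.1 alone**: the top fan-in estimate
(`rossmanServedioTan2015_w0_asymp_holds`, `AverageCaseDepthHierarchyProofs.lean`) and the
membership of the Sipser languages in `PH^A` (`sipserLang_mem_PHRel_holds`,
`RandomOraclePHSipserProofs.lean`) are theorems of the tree, so the average-case depth hierarchy
theorem `rossmanServedioTan2015_thm1_inRegime` is the ONLY remaining hypothesis of Thm. 2; its
discharge `rossmanServedioTan2015_thm2_holds` is this theorem applied to
`rossmanServedioTan2015_thm1_inRegime_holds` once that exists.
[cite: RossmanServedioTan2015, Thm. 2 (p. 3) and §2.3 (p. 7)] -/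
theorem rossmanServedioTan2015_thm2_of_inRegime (h1 : rossmanServedioTan2015_thm1_inRegime) :
    rossmanServedioTan2015_thm2 :=
  rossmanServedioTan2015_thm2_of h1 rossmanServedioTan2015_w0_asymp_holds sipserLang_mem_PHRel_holds

/-- **Thm. 2 from the literal transcription of Thm. 1** (which implies the regime-restricted one,
`rossmanServedioTan2015_thm1_inRegime_of_thm1`). [cite: RossmanServedioTan2015, Thm. 2 (p. 3) and §2.3 (p. 7)] -/
theorem rossmanServedioTan2015_thm2_of_thm1 (h1 : rossmanServedioTan2015_thm1) :
    rossmanServedioTan2015_thm2 :=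
  rossmanServedioTan2015_thm2_of_inRegime (rossmanServedioTan2015_thm1_inRegime_of_thm1 h1)

end Literature.Computability.Complexity

end
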